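import Literature.NumberTheory.Automorphic.UnitaryGroupAdelicLift
import Literature.NumberTheory.Automorphic.UnitaryGroupRationalRepresentatives
import HarnessLib

/-!
# The adelic lift and RIGHT TRANSLATION by `U(J)(𝔸_{F,f})`: piece functions of `x ↦ Φ (x · (1, g))`, generic rank `N`

Sequel of ★ `UnitaryGroupAdelicLift` (the dictionary «`Γ_q`-invariant piece functions on `U(σ_{w₁}J)(ℂ)` ↔ ONE function on
`U(J)(F)\U(J)(𝔸_F)/K_c K`», [BorelJacquet1979, §4.3]; [BorelWallach2000, XIII 1.2]).  For `g ∈ U(J)(𝔸_{F,f})` the RIGHT TRANSLATE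
`R_g Φ := x ↦ Φ (x · (1, g))` of such a function ([BorelJacquet1979, §4.2]: «`G(𝔸_f)` acts by right translations»; for the unitary
Shimura varieties it is the pull-back along the Hecke translate `T(g) : [x, aK] ↦ [x, agK′]`, [Milne2005ShimuraVarieties] §13 p. 118
L21–26, §5 p. 57–58) is again left `U(J)(F)`-invariant, right-invariant under the archimedean factor away from `w₁`, and right
`K`-invariant for every `K` with `g⁻¹Kg ⊆ K'` (§1); and ITS PIECE FUNCTIONS at level `K` are the level-`K'` piece functions of `Φ`
TRANSLATED ON THE ARCHIMEDEAN SIDE by a rational element (§2): if `g_q · g = γ_f · g'_{q'} · k'` (`k' ∈ K'`; such a decomposition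
exists for every `q` by the COVER property at level `K'`) then

  `(R_g Φ) (ι_{w₁}(u) · (1, g_q)) = Φ (ι_{w₁}(σ_{w₁}(γ)⁻¹ · u) · (1, g'_{q'}))`,

i.e. the piece function of `R_g Φ` on the piece `q` of level `K` is `u ↦ f_{q'} (σ_{w₁}(γ)⁻¹ u)` — on the disc∕ball quotients this is
the map `Γ_q \ 𝔻 → Γ'_{q'} \ 𝔻`, `[v] ↦ [σ_{w₁}(γ)⁻¹ v]`, through which `T(g)` restricts to the pieces ([Milne2005ShimuraVarieties] Lemma
5.13 p. 57: `[v, g_q g K'] = [γ⁻¹ v, g'_{q'} K']`).  §3 identifies `R_g Φ` as THE lift at level `K` of that translated family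
(uniqueness ★ `eq_of_forall_apply_adelicSingle_mul_eq`), and §4 restates §2 in the representative convention
`(γ_f · g_q g)⁻¹ · g'_{q'} ∈ K'` of ★ `UnitaryShimuraCurveHeckeComplex` (`exists_rational_inv_mul_rep_mem`), where the archimedean
translation is `u ↦ σ_{w₁}(γ) · u`.  §5 supplies the COVER and DISJOINT hypotheses of ★ `exists_lift_of_pieces` ∕
`eq_of_forall_apply_adelicSingle_mul_eq` from a family of REPRESENTATIVES `g_q` of `U(J)(F)\U(J)(𝔸_{F,f})/K` indexed by the double
coset space itself (the shape of the `pieces` clause of the canonical-model records ★ `RecordSystemGS.pieces` ∕ `RecordSystem.pieces`;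
★ `UnitaryGroupRationalRepresentatives`).

Rank-`N`, value-generic (`V`-valued functions), def-free: THEOREMS ONLY; no named fact, no instance, no notation, no `sorry`.
This is leg R5 («Hecke equivariance»), group-theoretic half, of the realisation of `H¹` of the unitary Shimura curves in cotangent
automorphic forms (cell `hodgecm-mathlib`, P5 line `F0_AlbCm`, sub-line S1-R); the geometric half (the translate intertwines the
cone uniformisations of the pieces) is `ShimuraVarieties/UnitaryShimuraCurveHeckeConeTransport`.

## References
* [BorelJacquet1979] A. Borel, H. Jacquet, *Automorphic forms and automorphic representations*, Corvallis PSPM 33.1 (1979), §4.1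
  (`G(𝔸) = G_∞ × G(𝔸_f)`), §4.2 (right translations by `G(𝔸_f)`), §4.3 (forms on `G(𝔸)` vs on the `Γ_i \ G_∞`).
* [BorelWallach2000] A. Borel, N. Wallach, *Continuous cohomology, discrete subgroups, and representations of reductive groups*,
  2nd ed. (2000), XIII 1.2 (`Γ\(G₁ × G₂)/L = ∐_c Γ'_c\G₁`).
* [Milne2005ShimuraVarieties] J. S. Milne, *Introduction to Shimura varieties* (2005/2017), §5 p. 57 L7–12, p. 58 L3–11 (the right
  action `T(g)`), Lemma 5.13 p. 57, §13 p. 118 L21–26.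
* [Deligne1979ShimuraVarieties] P. Deligne, Corvallis PSPM 33.2 (1979), 2.1.2–2.1.4.
-/

noncomputable section

open NumberField NumberField.InfinitePlace Topology MulAction

open scoped Matrix MatrixGroups ComplexConjugate ComplexOrder

namespace Literature.NumberTheory.Automorphic

namespace UnitaryGroup

open NumberField.mixedEmbedding

variable {F E : Type} [Field F] [NumberField F] [Field E] [NumberField E] [Algebra F E]
  {c : E ≃ₐ[F] E} {N : ℕ} {J : Matrix (Fin N) (Fin N) E}
  {hc : c ≠ 1} {hfix : ∀ w : InfinitePlace E, c • w = w} {w₁ : {w : InfinitePlace E // IsComplex w}}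

/-! ## §1 The three invariances of the right translate `x ↦ Φ (x · (1, g))` -/

/-- **Left `U(J)(F)`-invariance is preserved by right translation.** [cite: BorelJacquet1979, §4.2] -/
theorem rightTranslate_left_invariant {V : Type*} {Φ : (adelicGroupData F E c N J).Adelic → V}
    (hL : ∀ (γ : rational F E c N J) (x : (adelicGroupData F E c N J).Adelic),
      Φ ((adelicGroupData F E c N J).toAdelic γ * x) = Φ x)
    (g : finAdelic F E c N J) (γ : rational F E c N J) (x : (adelicGroupData F E c N J).Adelic) :
    Φ ((adelicGroupData F E c N J).toAdelic γ * x * finAdelicToAdelic F E c N J g) =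
      Φ (x * finAdelicToAdelic F E c N J g) := by
  rw [mul_assoc, hL]

/-- **Right-invariance under the archimedean factor away from `w₁` is preserved by right translation** (that factor commutes with
the finite-adelic factor, ★ `mul_finAdelicToAdelic_of_mem_map_ker_archAt`). [cite: BorelJacquet1979, §4.1–§4.2] -/
theorem rightTranslate_awayFrom_invariant {V : Type*} {Φ : (adelicGroupData F E c N J).Adelic → V}
    (hKc : ∀ k ∈ ((archAt F E c N J w₁ (hfix w₁.1) hc).ker).map (archToAdelic F E c N J),
      ∀ x : (adelicGroupData F E c N J).Adelic, Φ (x * k) = Φ x)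
    (g : finAdelic F E c N J) (k : (adelicGroupData F E c N J).Adelic)
    (hk : k ∈ ((archAt F E c N J w₁ (hfix w₁.1) hc).ker).map (archToAdelic F E c N J))
    (x : (adelicGroupData F E c N J).Adelic) :
    Φ (x * k * finAdelicToAdelic F E c N J g) = Φ (x * finAdelicToAdelic F E c N J g) := by
  rw [mul_assoc, mul_finAdelicToAdelic_of_mem_map_ker_archAt F E c N J hc hfix w₁ k hk g, ← mul_assoc, hKc k hk]

/-- **Right `K`-invariance of the translate for every level `K` with `g⁻¹Kg ⊆ K'`** (the level condition of the Hecke translate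
`T(g) : Sh_K → Sh_{K'}`, [Milne2005ShimuraVarieties] §13 p. 118 L21): `Φ (x k g) = Φ (x g (g⁻¹kg)) = Φ (x g)`.
[cite: Milne2005ShimuraVarieties, §13 p. 118 L21–26] [cite: BorelJacquet1979, §4.2] -/
theorem rightTranslate_level_invariant {V : Type*} {K K' : Subgroup (finAdelic F E c N J)}
    {Φ : (adelicGroupData F E c N J).Adelic → V}
    (hK' : ∀ k ∈ K', ∀ x : (adelicGroupData F E c N J).Adelic, Φ (x * finAdelicToAdelic F E c N J k) = Φ x)
    {g : finAdelic F E c N J} (hg : ∀ k ∈ K, g⁻¹ * k * g ∈ K') (k : finAdelic F E c N J) (hk : k ∈ K)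
    (x : (adelicGroupData F E c N J).Adelic) :
    Φ (x * finAdelicToAdelic F E c N J k * finAdelicToAdelic F E c N J g) = Φ (x * finAdelicToAdelic F E c N J g) := by
  have e : x * finAdelicToAdelic F E c N J k * finAdelicToAdelic F E c N J g =
      x * finAdelicToAdelic F E c N J g * finAdelicToAdelic F E c N J (g⁻¹ * k * g) := by
    simp only [map_mul, map_inv, mul_assoc, mul_inv_cancel_left]
  rw [e, hK' _ (hg k hk)]

/-! ## §2 The piece functions of the right translate -/

/-- **Piece functions of the right translate** (M3 cover convention): if `Φ` is left `U(J)(F)`-invariant, right `K'`-invariant and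
right-invariant under the archimedean factor away from `w₁`, and `g_q · g = γ_f · g'_{q'} · k'` with `k' ∈ K'`, then
`Φ (ι_{w₁}(u) · (1, g_q) · (1, g)) = Φ (ι_{w₁}(σ_{w₁}(γ)⁻¹ · u) · (1, g'_{q'}))` — the piece function of `x ↦ Φ (x · (1,g))` on the piece
`q` (representative `g_q`) is the piece function of `Φ` on the piece `q'` (representative `g'_{q'}`) translated by `σ_{w₁}(γ)⁻¹`
(★ `apply_eq_apply_adelicSingle_mul_of_finPart_eq` at the point `ι_{w₁}(u) · (1, g_q g)`).
[cite: BorelJacquet1979, §4.3] [cite: BorelWallach2000, XIII 1.2] [cite: Milne2005ShimuraVarieties, Lemma 5.13 p. 57 and §13 p. 118 L21–26] -/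
theorem apply_adelicSingle_mul_mul_finAdelicToAdelic_of_eq {V : Type*} {K' : Subgroup (finAdelic F E c N J)}
    {Φ : (adelicGroupData F E c N J).Adelic → V}
    (hL : ∀ (γ : rational F E c N J) (x : (adelicGroupData F E c N J).Adelic),
      Φ ((adelicGroupData F E c N J).toAdelic γ * x) = Φ x)
    (hKc : ∀ k ∈ ((archAt F E c N J w₁ (hfix w₁.1) hc).ker).map (archToAdelic F E c N J),
      ∀ x : (adelicGroupData F E c N J).Adelic, Φ (x * k) = Φ x)
    (hK' : ∀ k ∈ K', ∀ x : (adelicGroupData F E c N J).Adelic, Φ (x * finAdelicToAdelic F E c N J k) = Φ x)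
    {g gq gq' k' : finAdelic F E c N J} {γ : rational F E c N J} (hk' : k' ∈ K')
    (hx : gq * g = rationalToFinAdelic F E c N J γ * gq' * k') (u : archLocal E N J w₁) :
    Φ (adelicSingle F E c N J hc hfix w₁ u * finAdelicToAdelic F E c N J gq * finAdelicToAdelic F E c N J g) =
      Φ (adelicSingle F E c N J hc hfix w₁ ((rationalToArchLocal F E c N J w₁ (hfix w₁.1) hc γ)⁻¹ * u) *
        finAdelicToAdelic F E c N J gq') := by
  set x := adelicSingle F E c N J hc hfix w₁ u * finAdelicToAdelic F E c N J gq * finAdelicToAdelic F E c N J g with hxdef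
  have hfin : finPart F E c N J x = rationalToFinAdelic F E c N J γ * gq' * k' := by
    simp only [hxdef, map_mul, adelicSingle_apply, finPart_archToAdelic, one_mul, finPart_finAdelicToAdelic, hx]
  have harch : archAt F E c N J w₁ (hfix w₁.1) hc (archPart F E c N J x) = u := by
    simp only [hxdef, map_mul, archPart_finAdelicToAdelic, mul_one, adelicSingle_apply, archPart_archToAdelic,
      archAt_archSingle_self]
  rw [apply_eq_apply_adelicSingle_mul_of_finPart_eq hL hKc hK' hk' hfin, harch, map_inv]

/-- The same with the decomposition of `g_q · g` produced by a COVERING family of representatives `g' : Q' → U(J)(𝔸_{F,f})` at level `K'`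
(★ `exists_lift_of_pieces`' hypothesis `hcov`): for every `q` there are `q'`, `γ` with
`Φ (ι_{w₁}(u) · (1, g_q) · (1, g)) = Φ (ι_{w₁}(σ_{w₁}(γ)⁻¹ · u) · (1, g'_{q'}))` for all `u`.
[cite: BorelWallach2000, XIII 1.2] [cite: Milne2005ShimuraVarieties, Lemma 5.13 p. 57] -/
theorem exists_apply_adelicSingle_mul_mul_finAdelicToAdelic_eq {V : Type*} {K' : Subgroup (finAdelic F E c N J)} {Q' : Type*}
    {g' : Q' → finAdelic F E c N J}
    (hcov' : ∀ y : finAdelic F E c N J, ∃ (q' : Q') (γ : rational F E c N J) (k : finAdelic F E c N J),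
      k ∈ K' ∧ y = rationalToFinAdelic F E c N J γ * g' q' * k)
    {Φ : (adelicGroupData F E c N J).Adelic → V}
    (hL : ∀ (γ : rational F E c N J) (x : (adelicGroupData F E c N J).Adelic),
      Φ ((adelicGroupData F E c N J).toAdelic γ * x) = Φ x)
    (hKc : ∀ k ∈ ((archAt F E c N J w₁ (hfix w₁.1) hc).ker).map (archToAdelic F E c N J),
      ∀ x : (adelicGroupData F E c N J).Adelic, Φ (x * k) = Φ x)
    (hK' : ∀ k ∈ K', ∀ x : (adelicGroupData F E c N J).Adelic, Φ (x * finAdelicToAdelic F E c N J k) = Φ x)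
    (g gq : finAdelic F E c N J) :
    ∃ (q' : Q') (γ : rational F E c N J), ∀ u : archLocal E N J w₁,
      Φ (adelicSingle F E c N J hc hfix w₁ u * finAdelicToAdelic F E c N J gq * finAdelicToAdelic F E c N J g) =
        Φ (adelicSingle F E c N J hc hfix w₁ ((rationalToArchLocal F E c N J w₁ (hfix w₁.1) hc γ)⁻¹ * u) *
          finAdelicToAdelic F E c N J (g' q')) := by
  obtain ⟨q', γ, k', hk', hx⟩ := hcov' (gq * g)
  exact ⟨q', γ, fun u => apply_adelicSingle_mul_mul_finAdelicToAdelic_of_eq hL hKc hK' hk' hx u⟩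

/-! ## §3 The right translate is the lift of the translated family of piece functions -/

/-- **`R_g Φ` is THE lift, at level `K`, of the archimedean translates of the level-`K'` piece functions of `Φ`.**  Let `Φ` be left
`U(J)(F)`-invariant, right `K'`- and away-from-`w₁`-invariant with piece functions `f'_{q'}` on the representatives `g'` (so `Φ` is the
lift of ★ `exists_lift_of_pieces` at level `K'`); let `g⁻¹Kg ⊆ K'`, let `g_K : Q → U(J)(𝔸_{F,f})` be COVERING representatives at level `K`, and
for every `q` let `g_K(q) · g = γ_{q,f} · g'_{q'(q)} · k'_q` (`k'_q ∈ K'`).  Then ANY left `U(J)(F)`-invariant, right `K`- and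
away-from-`w₁`-invariant `Ψ` whose piece functions at level `K` are `u ↦ f'_{q'(q)} (σ_{w₁}(γ_q)⁻¹ u)` IS the right translate:
`Ψ = (x ↦ Φ (x · (1, g)))` (uniqueness ★ `eq_of_forall_apply_adelicSingle_mul_eq`).  For the unitary Shimura curves∕surfaces: the
adelic function of the pulled-back form `T(g)^* α` is the right translate of the adelic function of `α`.
[cite: BorelJacquet1979, §4.2–§4.3] [cite: BorelWallach2000, XIII 1.2] [cite: Milne2005ShimuraVarieties, §5 p. 58 L3–11 and §13 p. 118 L21–26] -/
theorem eq_rightTranslate_of_pieces {V : Type*} {K K' : Subgroup (finAdelic F E c N J)} {Q Q' : Type*}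
    {gK : Q → finAdelic F E c N J} {g' : Q' → finAdelic F E c N J}
    (hcov : ∀ y : finAdelic F E c N J, ∃ (q : Q) (γ : rational F E c N J) (k : finAdelic F E c N J),
      k ∈ K ∧ y = rationalToFinAdelic F E c N J γ * gK q * k)
    {Φ Ψ : (adelicGroupData F E c N J).Adelic → V} {f' : Q' → archLocal E N J w₁ → V}
    (hL : ∀ (γ : rational F E c N J) (x : (adelicGroupData F E c N J).Adelic),
      Φ ((adelicGroupData F E c N J).toAdelic γ * x) = Φ x)
    (hKc : ∀ k ∈ ((archAt F E c N J w₁ (hfix w₁.1) hc).ker).map (archToAdelic F E c N J),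
      ∀ x : (adelicGroupData F E c N J).Adelic, Φ (x * k) = Φ x)
    (hK' : ∀ k ∈ K', ∀ x : (adelicGroupData F E c N J).Adelic, Φ (x * finAdelicToAdelic F E c N J k) = Φ x)
    (hΦ : ∀ (q' : Q') (u : archLocal E N J w₁),
      Φ (adelicSingle F E c N J hc hfix w₁ u * finAdelicToAdelic F E c N J (g' q')) = f' q' u)
    {g : finAdelic F E c N J} (hg : ∀ k ∈ K, g⁻¹ * k * g ∈ K')
    {q' : Q → Q'} {γ : Q → rational F E c N J} {k' : Q → finAdelic F E c N J} (hk' : ∀ q, k' q ∈ K')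
    (hx : ∀ q, gK q * g = rationalToFinAdelic F E c N J (γ q) * g' (q' q) * k' q)
    (hL' : ∀ (γ : rational F E c N J) (x : (adelicGroupData F E c N J).Adelic),
      Ψ ((adelicGroupData F E c N J).toAdelic γ * x) = Ψ x)
    (hKc' : ∀ k ∈ ((archAt F E c N J w₁ (hfix w₁.1) hc).ker).map (archToAdelic F E c N J),
      ∀ x : (adelicGroupData F E c N J).Adelic, Ψ (x * k) = Ψ x)
    (hKΨ : ∀ k ∈ K, ∀ x : (adelicGroupData F E c N J).Adelic, Ψ (x * finAdelicToAdelic F E c N J k) = Ψ x)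
    (hΨ : ∀ (q : Q) (u : archLocal E N J w₁),
      Ψ (adelicSingle F E c N J hc hfix w₁ u * finAdelicToAdelic F E c N J (gK q)) =
        f' (q' q) ((rationalToArchLocal F E c N J w₁ (hfix w₁.1) hc (γ q))⁻¹ * u)) :
    Ψ = fun x => Φ (x * finAdelicToAdelic F E c N J g) := by
  refine eq_of_forall_apply_adelicSingle_mul_eq hcov hL' hKc' hKΨ
    (fun γ₀ x => rightTranslate_left_invariant hL g γ₀ x)
    (fun k hk x => rightTranslate_awayFrom_invariant hKc g k hk x)
    (fun k hk x => rightTranslate_level_invariant hK' hg k hk x) fun q u => ?_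
  show Ψ _ = Φ (_ * _)
  rw [hΨ q u, apply_adelicSingle_mul_mul_finAdelicToAdelic_of_eq hL hKc hK' (hk' q) (hx q) u, hΦ]

/-- **Pointwise form**: under the hypotheses of `eq_rightTranslate_of_pieces`, `Ψ x = Φ (x · (1, g))` for every adelic `x`.
[cite: BorelJacquet1979, §4.2–§4.3] [cite: BorelWallach2000, XIII 1.2] -/
theorem apply_eq_apply_mul_finAdelicToAdelic_of_pieces {V : Type*} {K K' : Subgroup (finAdelic F E c N J)} {Q Q' : Type*}
    {gK : Q → finAdelic F E c N J} {g' : Q' → finAdelic F E c N J}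
    (hcov : ∀ y : finAdelic F E c N J, ∃ (q : Q) (γ : rational F E c N J) (k : finAdelic F E c N J),
      k ∈ K ∧ y = rationalToFinAdelic F E c N J γ * gK q * k)
    {Φ Ψ : (adelicGroupData F E c N J).Adelic → V} {f' : Q' → archLocal E N J w₁ → V}
    (hL : ∀ (γ : rational F E c N J) (x : (adelicGroupData F E c N J).Adelic),
      Φ ((adelicGroupData F E c N J).toAdelic γ * x) = Φ x)
    (hKc : ∀ k ∈ ((archAt F E c N J w₁ (hfix w₁.1) hc).ker).map (archToAdelic F E c N J),
      ∀ x : (adelicGroupData F E c N J).Adelic, Φ (x * k) = Φ x)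
    (hK' : ∀ k ∈ K', ∀ x : (adelicGroupData F E c N J).Adelic, Φ (x * finAdelicToAdelic F E c N J k) = Φ x)
    (hΦ : ∀ (q' : Q') (u : archLocal E N J w₁),
      Φ (adelicSingle F E c N J hc hfix w₁ u * finAdelicToAdelic F E c N J (g' q')) = f' q' u)
    {g : finAdelic F E c N J} (hg : ∀ k ∈ K, g⁻¹ * k * g ∈ K')
    {q' : Q → Q'} {γ : Q → rational F E c N J} {k' : Q → finAdelic F E c N J} (hk' : ∀ q, k' q ∈ K')
    (hx : ∀ q, gK q * g = rationalToFinAdelic F E c N J (γ q) * g' (q' q) * k' q)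
    (hL' : ∀ (γ : rational F E c N J) (x : (adelicGroupData F E c N J).Adelic),
      Ψ ((adelicGroupData F E c N J).toAdelic γ * x) = Ψ x)
    (hKc' : ∀ k ∈ ((archAt F E c N J w₁ (hfix w₁.1) hc).ker).map (archToAdelic F E c N J),
      ∀ x : (adelicGroupData F E c N J).Adelic, Ψ (x * k) = Ψ x)
    (hKΨ : ∀ k ∈ K, ∀ x : (adelicGroupData F E c N J).Adelic, Ψ (x * finAdelicToAdelic F E c N J k) = Ψ x)
    (hΨ : ∀ (q : Q) (u : archLocal E N J w₁),
      Ψ (adelicSingle F E c N J hc hfix w₁ u * finAdelicToAdelic F E c N J (gK q)) =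
        f' (q' q) ((rationalToArchLocal F E c N J w₁ (hfix w₁.1) hc (γ q))⁻¹ * u))
    (x : (adelicGroupData F E c N J).Adelic) :
    Ψ x = Φ (x * finAdelicToAdelic F E c N J g) :=
  congrFun (eq_rightTranslate_of_pieces hcov hL hKc hK' hΦ hg hk' hx hL' hKc' hKΨ hΨ) x

/-! ## §4 The representative convention `(γ_f · g_q g)⁻¹ · g'_{q'} ∈ K'` (translation by `σ_{w₁}(γ)`) -/

omit [NumberField F] in
/-- Dictionary between the two conventions: `(γ_f · g_q g)⁻¹ · g'_{q'} ∈ K'` iff `g_q · g = (γ⁻¹)_f · g'_{q'} · k'` with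
`k' := ((γ_f g_q g)⁻¹ g'_{q'})⁻¹ ∈ K'`. [cite: Milne2005ShimuraVarieties, Lemma 5.13 p. 57] -/
theorem mul_eq_of_inv_mul_mem {K' : Subgroup (finAdelic F E c N J)} {g gq gq' : finAdelic F E c N J} {γ : rational F E c N J}
    (h : (rationalToFinAdelic F E c N J γ * (gq * g))⁻¹ * gq' ∈ K') :
    ((rationalToFinAdelic F E c N J γ * (gq * g))⁻¹ * gq')⁻¹ ∈ K' ∧
      gq * g = rationalToFinAdelic F E c N J γ⁻¹ * gq' * ((rationalToFinAdelic F E c N J γ * (gq * g))⁻¹ * gq')⁻¹ :=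
  ⟨K'.inv_mem h, by rw [map_inv]; group⟩

/-- **Piece functions of the right translate, representative convention**: if `(γ_f · g_q g)⁻¹ · g'_{q'} ∈ K'` (the choice made by ★
`exists_rational_inv_mul_rep_mem` ∕ ★ `RecordSystemGS.exists_heckeComplex`, under which `T(g)` maps the piece `q` to the piece `q'` by
`[v] ↦ [σ_{w₁}(γ) v]`), then `Φ (ι_{w₁}(u) · (1, g_q) · (1, g)) = Φ (ι_{w₁}(σ_{w₁}(γ) · u) · (1, g'_{q'}))`.
[cite: Milne2005ShimuraVarieties, Lemma 5.13 p. 57 and §13 p. 118 L21–26] [cite: BorelJacquet1979, §4.3] -/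
theorem apply_adelicSingle_mul_mul_finAdelicToAdelic_of_inv_mul_mem {V : Type*} {K' : Subgroup (finAdelic F E c N J)}
    {Φ : (adelicGroupData F E c N J).Adelic → V}
    (hL : ∀ (γ : rational F E c N J) (x : (adelicGroupData F E c N J).Adelic),
      Φ ((adelicGroupData F E c N J).toAdelic γ * x) = Φ x)
    (hKc : ∀ k ∈ ((archAt F E c N J w₁ (hfix w₁.1) hc).ker).map (archToAdelic F E c N J),
      ∀ x : (adelicGroupData F E c N J).Adelic, Φ (x * k) = Φ x)
    (hK' : ∀ k ∈ K', ∀ x : (adelicGroupData F E c N J).Adelic, Φ (x * finAdelicToAdelic F E c N J k) = Φ x)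
    {g gq gq' : finAdelic F E c N J} {γ : rational F E c N J}
    (h : (rationalToFinAdelic F E c N J γ * (gq * g))⁻¹ * gq' ∈ K') (u : archLocal E N J w₁) :
    Φ (adelicSingle F E c N J hc hfix w₁ u * finAdelicToAdelic F E c N J gq * finAdelicToAdelic F E c N J g) =
      Φ (adelicSingle F E c N J hc hfix w₁ (rationalToArchLocal F E c N J w₁ (hfix w₁.1) hc γ * u) *
        finAdelicToAdelic F E c N J gq') := by
  obtain ⟨hk', hx⟩ := mul_eq_of_inv_mul_mem h
  rw [apply_adelicSingle_mul_mul_finAdelicToAdelic_of_eq hL hKc hK' hk' hx u, map_inv, inv_inv]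

/-- **`R_g Φ` is the lift of the `σ_{w₁}(γ_q)`-translated family, representative convention** (pointwise): with
`(γ_{q,f} · g_K(q) g)⁻¹ · g'_{q'(q)} ∈ K'` for every `q` and `Ψ`'s level-`K` piece functions `u ↦ f'_{q'(q)} (σ_{w₁}(γ_q) · u)`,
`Ψ x = Φ (x · (1, g))`. [cite: BorelJacquet1979, §4.2–§4.3] [cite: BorelWallach2000, XIII 1.2] [cite: Milne2005ShimuraVarieties, §13 p. 118 L21–26] -/
theorem apply_eq_apply_mul_finAdelicToAdelic_of_pieces' {V : Type*} {K K' : Subgroup (finAdelic F E c N J)} {Q Q' : Type*}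
    {gK : Q → finAdelic F E c N J} {g' : Q' → finAdelic F E c N J}
    (hcov : ∀ y : finAdelic F E c N J, ∃ (q : Q) (γ : rational F E c N J) (k : finAdelic F E c N J),
      k ∈ K ∧ y = rationalToFinAdelic F E c N J γ * gK q * k)
    {Φ Ψ : (adelicGroupData F E c N J).Adelic → V} {f' : Q' → archLocal E N J w₁ → V}
    (hL : ∀ (γ : rational F E c N J) (x : (adelicGroupData F E c N J).Adelic),
      Φ ((adelicGroupData F E c N J).toAdelic γ * x) = Φ x)
    (hKc : ∀ k ∈ ((archAt F E c N J w₁ (hfix w₁.1) hc).ker).map (archToAdelic F E c N J),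
      ∀ x : (adelicGroupData F E c N J).Adelic, Φ (x * k) = Φ x)
    (hK' : ∀ k ∈ K', ∀ x : (adelicGroupData F E c N J).Adelic, Φ (x * finAdelicToAdelic F E c N J k) = Φ x)
    (hΦ : ∀ (q' : Q') (u : archLocal E N J w₁),
      Φ (adelicSingle F E c N J hc hfix w₁ u * finAdelicToAdelic F E c N J (g' q')) = f' q' u)
    {g : finAdelic F E c N J} (hg : ∀ k ∈ K, g⁻¹ * k * g ∈ K')
    {q' : Q → Q'} {γ : Q → rational F E c N J}
    (hγ : ∀ q, (rationalToFinAdelic F E c N J (γ q) * (gK q * g))⁻¹ * g' (q' q) ∈ K')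
    (hL' : ∀ (γ : rational F E c N J) (x : (adelicGroupData F E c N J).Adelic),
      Ψ ((adelicGroupData F E c N J).toAdelic γ * x) = Ψ x)
    (hKc' : ∀ k ∈ ((archAt F E c N J w₁ (hfix w₁.1) hc).ker).map (archToAdelic F E c N J),
      ∀ x : (adelicGroupData F E c N J).Adelic, Ψ (x * k) = Ψ x)
    (hKΨ : ∀ k ∈ K, ∀ x : (adelicGroupData F E c N J).Adelic, Ψ (x * finAdelicToAdelic F E c N J k) = Ψ x)
    (hΨ : ∀ (q : Q) (u : archLocal E N J w₁),
      Ψ (adelicSingle F E c N J hc hfix w₁ u * finAdelicToAdelic F E c N J (gK q)) =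
        f' (q' q) (rationalToArchLocal F E c N J w₁ (hfix w₁.1) hc (γ q) * u))
    (x : (adelicGroupData F E c N J).Adelic) :
    Ψ x = Φ (x * finAdelicToAdelic F E c N J g) := by
  refine apply_eq_apply_mul_finAdelicToAdelic_of_pieces hcov hL hKc hK' hΦ hg (q' := q') (γ := fun q => (γ q)⁻¹)
    (k' := fun q => ((rationalToFinAdelic F E c N J (γ q) * (gK q * g))⁻¹ * g' (q' q))⁻¹)
    (fun q => (mul_eq_of_inv_mul_mem (hγ q)).1) (fun q => (mul_eq_of_inv_mul_mem (hγ q)).2) hL' hKc' hKΨ (fun q u => ?_) x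
  rw [hΨ q u, map_inv, inv_inv]

/-! ## §5 Representatives of `U(J)(F)\U(J)(𝔸_{F,f})/K` give the COVER and DISJOINT hypotheses of the lift -/

omit [NumberField F] in
/-- **COVER from representatives**: if `g_q` represents the double class `q` for every `q ∈ U(J)(F)\U(J)(𝔸_{F,f})/K` (the
`pieces` convention `Quotient.mk'' (pt (g_q)) = q`), then every `y ∈ U(J)(𝔸_{F,f})` is `γ_f · g_q · k` with `k ∈ K` (★
`exists_rational_smul_rep_mem`: `(γ'_f y)⁻¹ g_{[y]} ∈ K`, read with `γ = γ'⁻¹`). [cite: Milne2005ShimuraVarieties, Lemma 5.13 p. 57]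
[cite: BorelWallach2000, XIII 1.2] -/
theorem cover_of_representatives {K : Subgroup (finAdelic F E c N J)}
    {gq : orbitRel.Quotient (rational F E c N J) (ShimuraDissection.CosetSpace (rationalToFinAdelic F E c N J) K) →
      finAdelic F E c N J}
    (hgq : ∀ q, Quotient.mk'' (ShimuraDissection.CosetSpace.pt (rationalToFinAdelic F E c N J) K (gq q)) = q)
    (y : finAdelic F E c N J) :
    ∃ (q : orbitRel.Quotient (rational F E c N J) (ShimuraDissection.CosetSpace (rationalToFinAdelic F E c N J) K))
      (γ : rational F E c N J) (k : finAdelic F E c N J), k ∈ K ∧ y = rationalToFinAdelic F E c N J γ * gq q * k := by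
  obtain ⟨γ, hγ⟩ := exists_rational_smul_rep_mem hgq y
  refine ⟨Quotient.mk'' (ShimuraDissection.CosetSpace.pt (rationalToFinAdelic F E c N J) K y), γ⁻¹,
    ((rationalToFinAdelic F E c N J γ * y)⁻¹ *
      gq (Quotient.mk'' (ShimuraDissection.CosetSpace.pt (rationalToFinAdelic F E c N J) K y)))⁻¹, K.inv_mem hγ, ?_⟩
  rw [map_inv]
  group

omit [NumberField F] in
/-- The double class of `γ_f · g_q · k` (`k ∈ K`) is `q`. [cite: Milne2005ShimuraVarieties, Lemma 5.13 p. 57] -/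
theorem mk_pt_mul_rep_mul_eq {K : Subgroup (finAdelic F E c N J)}
    {gq : orbitRel.Quotient (rational F E c N J) (ShimuraDissection.CosetSpace (rationalToFinAdelic F E c N J) K) →
      finAdelic F E c N J}
    (hgq : ∀ q, Quotient.mk'' (ShimuraDissection.CosetSpace.pt (rationalToFinAdelic F E c N J) K (gq q)) = q)
    (q : orbitRel.Quotient (rational F E c N J) (ShimuraDissection.CosetSpace (rationalToFinAdelic F E c N J) K))
    (γ : rational F E c N J) {k : finAdelic F E c N J} (hk : k ∈ K) :
    Quotient.mk'' (ShimuraDissection.CosetSpace.pt (rationalToFinAdelic F E c N J) K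
        (rationalToFinAdelic F E c N J γ * gq q * k)) = q := by
  conv_rhs => rw [← hgq q]
  refine Quotient.sound (orbitRel_apply.mpr (mem_orbit_iff.mpr ⟨γ, ?_⟩))
  rw [ShimuraDissection.CosetSpace.smul_pt, ShimuraDissection.CosetSpace.pt_eq_pt_iff]
  simpa only [mul_inv_rev, mul_assoc, inv_mul_cancel_left] using hk

omit [NumberField F] in
/-- **DISJOINT from representatives**: `γ_f · g_q · k = γ'_f · g_{q'} · k'` with `k, k' ∈ K` forces `q = q'` (both sides have double
class `q`, resp. `q'`). [cite: Milne2005ShimuraVarieties, Lemma 5.13 p. 57] [cite: BorelWallach2000, XIII 1.2] -/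
theorem disjoint_of_representatives {K : Subgroup (finAdelic F E c N J)}
    {gq : orbitRel.Quotient (rational F E c N J) (ShimuraDissection.CosetSpace (rationalToFinAdelic F E c N J) K) →
      finAdelic F E c N J}
    (hgq : ∀ q, Quotient.mk'' (ShimuraDissection.CosetSpace.pt (rationalToFinAdelic F E c N J) K (gq q)) = q)
    (q q' : orbitRel.Quotient (rational F E c N J) (ShimuraDissection.CosetSpace (rationalToFinAdelic F E c N J) K))
    (γ γ' : rational F E c N J) (k k' : finAdelic F E c N J) (hk : k ∈ K) (hk' : k' ∈ K)
    (h : rationalToFinAdelic F E c N J γ * gq q * k = rationalToFinAdelic F E c N J γ' * gq q' * k') : q = q' := by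
  rw [← mk_pt_mul_rep_mul_eq hgq q γ hk, ← mk_pt_mul_rep_mul_eq hgq q' γ' hk', h]

end UnitaryGroup

end Literature.NumberTheory.Automorphic

end
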